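import Literature.AlgebraicGeometry.Motives.AbelianVarietyQuotientAction
import Literature.AlgebraicGeometry.Motives.GeometricallyReducedPerfectField
import Mathlib.AlgebraicGeometry.Sites.Fpqc
import Mathlib.FieldTheory.Normal.Defs
import HarnessLib

/-!
# The Galois action on `End(P_L)` and Galois descent of endomorphisms of abelian varieties

Tate's Main Theorem over a finite field `K` (`tate_bijective_of_finite`, `TateAbelianFinite`;
J. Tate, Invent. Math. 2 (1966)) is assembled in
`Motives/AbelianVarietyEndAlgebraDescent` from the Theorem of the Cube, Poincaré's complete
reducibility theorem over `K̄`, finiteness of isomorphism classes, quotients, and **Galois descent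
data for `End(P_K̄)`**, `P = A ⊞ B`: an action of a group `Γ` on `End(P_K̄)` by ring
automorphisms fixing the base changes `f_K̄` (`hfix`) such that fixed endomorphisms descend
(`hdesc`) and `Γ` acts through finitely many automorphisms (`hΓ`). This file constructs the
action of `Γ = Aut(L/K)` on `End(P_L)` for any extension `L/K` and proves `hfix` and — for `K`
perfect and `L/K` normal, e.g. `L = K̄` — `hdesc`:

* `AbelianVariety.twist σ = Over.pullback (Spec σ)`, `twistIso σ : bcFunctor K L ⋙ twist σ ≅
  bcFunctor K L` (the twist of a base change by `σ ∈ Aut(L/K)` is the base change), hence an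
  isomorphism of group `L`-schemes `twistGrpIso σ P : (P_L)^σ ≅ P_L` (Mathlib
  `Functor.mapGrpNatIso`: natural transformations of cartesian-monoidal functors are monoidal);
* `AbelianVariety.galConj σ r` — **the Galois conjugate `σ • r`** of `r ∈ End(P_L)`, the transport
  of `r` along `twistGrpIso`, an endomorphism of the abelian variety `P_L`; on schemes
  `σ • r = gal σ⁻¹ ≫ r ≫ gal σ` (`toSchemeHom_galConj`; `gal τ = 1 × Spec τ⁻¹` of
  `AbelianVarietyQuotientAction`), and `instMulSemiringActionEnd : MulSemiringAction (L ≃ₐ[K] L)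
  (End (P.baseChange L))` (additivity from Mathlib `Functor.map_mul` for the monoidal twist);
* `hfix`: `smul_end_baseChange : σ • f_L = f_L`;
* `hdesc`: `exists_end_of_baseChange_eq_of_forall_smul_eq` — **over a perfect field `K`, for `L/K`
  normal, every `Aut(L/K)`-fixed endomorphism of `P_L` is `f_L` for a (unique) `f ∈ End(P)`**.
  Proof: a fixed `r` commutes with the `gal σ` (`gal_comp_toSchemeHom_of_galConj_eq`); `r ≫ pr`
  coequalises the kernel pair `Y ×_P Y ⇉ Y` of `pr : Y = P ×_K Spec L → P`
  (`fst_comp_eq_snd_comp_of_forall_gal_comp`: `Y ×_P Y` is reduced — `pr` is flat and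
  geometrically reduced for `K` perfect, EGA IV₂ (4.6.1), `GeometricallyReducedPerfectField`, and
  Mathlib `GeometricallyReduced.isReduced_of_flat_of_isLocallyNoetherian` — so the equation is
  checked on field-valued points, Mathlib `ext_of_fromSpecResidueField_eq`, where two points of `Y`
  over the same point of `P` differ by some `gal γ`, two `K`-embeddings of the normal `L` into a
  field differing by an automorphism, Mathlib `AlgHom.restrictNormal'`); hence `r ≫ pr` descends
  along the fpqc covering `pr` (Görtz–Wedhorn I, Thm. 14.72 (1); Mathlib `EffectiveEpi.desc` for
  flat surjective quasi-compact morphisms, `AlgebraicGeometry.Sites.Fpqc`) to `r₀ : P → P`, a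
  homomorphism because its base change `r` is one and base change is faithful and monoidal
  (`one_descentOver`, `mul_descentOver`, the argument of Mathlib `FullyFaithful.isMonHom_preimage`).

This is Galois descent for morphisms (Görtz–Wedhorn I, (14.20), Thm. 14.86 for finite Galois
coverings of quasi-projective schemes) in the form needed here: infinite normal extensions are
allowed because only morphisms (not objects) are descended, along an effective epimorphism.
Everything is proved; no definition of a notion, no named fact (D-0026). The finiteness `hΓ` of
the image of `Aut(K̄/K)` (which needs `End(P_K̄)` finitely generated) is not in this file.

## References

* [GortzWedhorn2020] U. Görtz, T. Wedhorn, *Algebraic Geometry I*, 2nd ed. (2020): Thm. 14.72 (1)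
  (fpqc descent of morphisms), Def. 14.84, (14.20.1), Thm. 14.86 (Galois descent) — held copy,
  PDF pp. 581, 585–587, read.
* [Milne1986AbelianVarieties] J. S. Milne, *Abelian Varieties*, in Cornell–Silverman (1986), §16.
* [Tate1966Endomorphisms] J. Tate, *Endomorphisms of abelian varieties over finite fields*,
  Invent. Math. 2 (1966), 134–144 (the consumer: `End_k(A) = End_{k̄}(A)^{Gal}`).

## Design

`set_option backward.isDefEq.respectTransparency false` is needed throughout (as in Mathlib's
`Over.pullback` and the `Grp`/`InducedCategory` API): the objects `(bcFunctor K L).obj X`,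
`Grp (SchemeOver L)` unfold only at default transparency. `galConj` is typed on morphisms
`P.baseChange L ⟶ P.baseChange L`; the action instance is on Mathlib's `End (P.baseChange L)`
(a high-priority `SMul` instance short-circuits an otherwise very slow instance search).
-/

noncomputable section

universe u

open CategoryTheory CategoryTheory.Limits AlgebraicGeometry MonoidalCategory CartesianMonoidalCategory

namespace Literature.AlgebraicGeometry.Motives

namespace AbelianVariety

open scoped MonObj Obj

set_option backward.isDefEq.respectTransparency false

variable {K : Type u} [Field K] (L : Type u) [Field L] [Algebra K L]

/-- `Spec σ : Spec L → Spec L` for `σ ∈ Aut(L/K)` (underlying scheme map of `AlgPoints.specMap σ`). [folklore] -/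
abbrev specAut (σ : L ≃ₐ[K] L) : Spec (.of L) ⟶ Spec (.of L) :=
  Spec.map (CommRingCat.ofHom (σ : L →+* L))

/-- `Spec (σ τ) = Spec σ ≫ Spec τ` (contravariance of `Spec`, `σ τ = σ ∘ τ`). [folklore] -/
theorem specAut_mul (σ τ : L ≃ₐ[K] L) : specAut L (σ * τ) = specAut L σ ≫ specAut L τ :=
  congrArg CommaMorphism.left (AlgPoints.specMap_mul (k := K) σ τ)

/-- `Spec 1 = 𝟙`. [folklore] -/
theorem specAut_one : specAut L (1 : L ≃ₐ[K] L) = 𝟙 _ :=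
  congrArg CommaMorphism.left (AlgPoints.specMap_one (k := K) (L := L))

/-- `Spec σ` is a morphism over `Spec K`. [folklore] -/
@[reassoc]
theorem specAut_comp_bcSpec (σ : L ≃ₐ[K] L) : specAut L σ ≫ bcSpec K L = bcSpec K L :=
  Over.w (AlgPoints.specMap (k := K) σ)

/-- The twist functor `X ↦ X ×_{Spec L, Spec σ} Spec L` on `L`-schemes. [folklore] -/
abbrev twist (σ : L ≃ₐ[K] L) : SchemeOver L ⥤ SchemeOver L := Over.pullback (specAut L σ)

variable (σ : L ≃ₐ[K] L)

/-- The underlying scheme of `X_L` is `X ×_K Spec L` (by `rfl`). [folklore] -/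
theorem bcFunctor_obj_left (X : SchemeOver K) :
    ((bcFunctor K L).obj X).left = pullback X.hom (bcSpec K L) := rfl

/-- The structure morphism of `X_L` is the second projection (by `rfl`). [folklore] -/
theorem bcFunctor_obj_hom (X : SchemeOver K) :
    ((bcFunctor K L).obj X).hom = pullback.snd X.hom (bcSpec K L) := rfl

/-- The underlying scheme of the twist of `X_L` (by `rfl`). [folklore] -/
theorem twist_bcFunctor_obj_left (X : SchemeOver K) :
    ((bcFunctor K L ⋙ twist L σ).obj X).left =
      pullback (pullback.snd X.hom (bcSpec K L)) (specAut L σ) := rfl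

/-- The structure morphism of the twist of `X_L` (by `rfl`). [folklore] -/
theorem twist_bcFunctor_obj_hom (X : SchemeOver K) :
    ((bcFunctor K L ⋙ twist L σ).obj X).hom =
      pullback.snd (pullback.snd X.hom (bcSpec K L)) (specAut L σ) := rfl

/-- For a `K`-scheme `X`, the scheme isomorphism `(X_L) ×_{Spec L, Spec σ} Spec L ≅ X_L`,
`((x, t'), t) ↦ (x, t)` with inverse `(x, t) ↦ ((x, σ t), t)`. [folklore] -/
def twistIsoLeft (X : SchemeOver K) :
    pullback (pullback.snd X.hom (bcSpec K L)) (specAut L σ) ≅ pullback X.hom (bcSpec K L) where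
  hom := pullback.lift (pullback.fst _ _ ≫ pullback.fst _ _) (pullback.snd _ _) (by
    rw [Category.assoc, pullback.condition, pullback.condition_assoc, specAut_comp_bcSpec])
  inv := pullback.lift (pullback.lift (pullback.fst _ _) (pullback.snd _ _ ≫ specAut L σ) (by
    rw [Category.assoc, specAut_comp_bcSpec, pullback.condition])) (pullback.snd _ _)
    (pullback.lift_snd _ _ _)
  hom_inv_id := by
    apply pullback.hom_ext
    · apply pullback.hom_ext
      · simp
      · simp only [Category.assoc, pullback.lift_fst_assoc, pullback.lift_snd, pullback.lift_snd_assoc,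
          Category.id_comp]
        exact (pullback.condition (f := pullback.snd X.hom (bcSpec K L)) (g := specAut L σ)).symm
    · simp
  inv_hom_id := by
    apply pullback.hom_ext <;> simp

/-- `twistIsoLeft` followed by the first projection. [folklore] -/
@[reassoc (attr := simp)]
theorem twistIsoLeft_hom_fst (X : SchemeOver K) :
    (twistIsoLeft L σ X).hom ≫ pullback.fst _ _ = pullback.fst _ _ ≫ pullback.fst _ _ :=
  pullback.lift_fst _ _ _

/-- `twistIsoLeft` followed by the second projection. [folklore] -/
@[reassoc (attr := simp)]
theorem twistIsoLeft_hom_snd (X : SchemeOver K) :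
    (twistIsoLeft L σ X).hom ≫ pullback.snd _ _ = pullback.snd _ _ :=
  pullback.lift_snd _ _ _

/-- The inverse of `twistIsoLeft` followed by `pr₁ ≫ pr₁`. [folklore] -/
@[reassoc (attr := simp)]
theorem twistIsoLeft_inv_fst_fst (X : SchemeOver K) :
    (twistIsoLeft L σ X).inv ≫ pullback.fst _ _ ≫ pullback.fst _ _ = pullback.fst _ _ := by
  simp [twistIsoLeft]

/-- The inverse of `twistIsoLeft` followed by `pr₁ ≫ pr₂` is `pr₂ ≫ Spec σ`. [folklore] -/
@[reassoc (attr := simp)]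
theorem twistIsoLeft_inv_fst_snd (X : SchemeOver K) :
    (twistIsoLeft L σ X).inv ≫ pullback.fst _ _ ≫ pullback.snd _ _ =
      pullback.snd _ _ ≫ specAut L σ := by
  simp [twistIsoLeft]

/-- The inverse of `twistIsoLeft` followed by `pr₂`. [folklore] -/
@[reassoc (attr := simp)]
theorem twistIsoLeft_inv_snd (X : SchemeOver K) :
    (twistIsoLeft L σ X).inv ≫ pullback.snd _ _ = pullback.snd _ _ := by
  simp [twistIsoLeft]

/-- The natural isomorphism `bcFunctor K L ⋙ twist σ ≅ bcFunctor K L`. [folklore] -/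
def twistIso : bcFunctor K L ⋙ twist L σ ≅ bcFunctor K L :=
  NatIso.ofComponents (fun X ↦ Over.isoMk (twistIsoLeft L σ X) (twistIsoLeft_hom_snd L σ X)) (by
    intro X Y f
    ext : 1
    change (pullback.lift (pullback.fst _ _ ≫ pullback.lift (pullback.fst _ _ ≫ f.left)
        (pullback.snd _ _) _) (pullback.snd _ _) _) ≫ (twistIsoLeft L σ Y).hom =
      (twistIsoLeft L σ X).hom ≫ pullback.lift (pullback.fst _ _ ≫ f.left) (pullback.snd _ _) _
    apply pullback.hom_ext
    · simp
    · simp)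

/-- The components of `twistIso` on underlying schemes (by `rfl`). [folklore] -/
@[simp]
theorem twistIso_hom_app_left (X : SchemeOver K) :
    ((twistIso L σ).hom.app X).left = (twistIsoLeft L σ X).hom := rfl

/-- The components of `twistIso⁻¹` on underlying schemes (by `rfl`). [folklore] -/
@[simp]
theorem twistIso_inv_app_left (X : SchemeOver K) :
    ((twistIso L σ).inv.app X).left = (twistIsoLeft L σ X).inv := rfl


/-! ### The Galois conjugate of an endomorphism of `P_L` -/

variable (P : AbelianVariety K)

/-- The isomorphism of group `L`-schemes `(P_L) ×_{Spec L, Spec σ} Spec L ≅ P_L` (the twist of the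
base change is the base change, as group objects: `mapGrp` of `twistIso`). [folklore] -/
def twistGrpIso : (twist L σ).mapGrp.obj (P.baseChange L).toGrp ≅ (P.baseChange L).toGrp :=
  ((Functor.mapGrpCompIso (F := bcFunctor K L) (G := twist L σ)).app P.toGrp).symm ≪≫
    (Functor.mapGrpNatIso (twistIso L σ)).app P.toGrp

/-- `twistGrpIso` on underlying schemes is `twistIsoLeft`. [folklore] -/
theorem twistGrpIso_hom_hom_hom_left :
    (twistGrpIso L σ P).hom.hom.hom.left = (twistIsoLeft L σ P.X).hom := by
  simp [twistGrpIso]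
  rfl

/-- `twistGrpIso⁻¹` on underlying schemes is `twistIsoLeft⁻¹`. [folklore] -/
theorem twistGrpIso_inv_hom_hom_left :
    (twistGrpIso L σ P).inv.hom.hom.left = (twistIsoLeft L σ P.X).inv := by
  simp [twistGrpIso]
  rfl

/-- **The Galois conjugate `σ • r` of an endomorphism `r` of `P_L`**: the transport of `r` along
the twist by `Spec σ`, an endomorphism of the abelian variety `P_L`. [folklore] -/
def galConj (r : P.baseChange L ⟶ P.baseChange L) : P.baseChange L ⟶ P.baseChange L :=
  InducedCategory.homMk
    ((twistGrpIso L σ P).inv ≫ (twist L σ).mapGrp.map r.hom ≫ (twistGrpIso L σ P).hom)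

/-- `σ • r` on underlying schemes, in terms of `twistIsoLeft`. [folklore] -/
theorem toSchemeHom_galConj' (r : P.baseChange L ⟶ P.baseChange L) :
    Hom.toSchemeHom (P.galConj L σ r) =
      (twistIsoLeft L σ P.X).inv ≫ ((twist L σ).map r.hom.hom.hom).left ≫
        (twistIsoLeft L σ P.X).hom := by
  rw [← twistGrpIso_hom_hom_hom_left, ← twistGrpIso_inv_hom_hom_left]
  rfl

/-- `(twistIsoLeft σ P).inv ≫ pr₁ = gal σ⁻¹ = 1 × Spec σ`. [folklore] -/
@[reassoc]
theorem twistIsoLeft_inv_fst :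
    (twistIsoLeft L σ P.X).inv ≫ pullback.fst _ _ = P.gal L σ⁻¹ := by
  apply pullback.hom_ext
  · rw [Category.assoc, twistIsoLeft_inv_fst_fst, gal_fst]
  · rw [Category.assoc, twistIsoLeft_inv_fst_snd, gal_snd, inv_inv]

/-- `Spec σ ≫ Spec σ⁻¹ = 𝟙`. [folklore] -/
theorem specAut_comp_specAut_symm : specAut L σ ≫ specAut L σ⁻¹ = 𝟙 _ := by
  rw [← specAut_mul, mul_inv_cancel, specAut_one]

/-- `Spec σ⁻¹ ≫ Spec σ = 𝟙`. [folklore] -/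
theorem specAut_symm_comp_specAut : specAut L σ⁻¹ ≫ specAut L σ = 𝟙 _ := by
  rw [← specAut_mul, inv_mul_cancel, specAut_one]

/-- **On schemes, `σ • r = gal σ⁻¹ ≫ r ≫ gal σ`** (`gal τ = 1 × Spec τ⁻¹`). [folklore] -/
theorem toSchemeHom_galConj (r : P.baseChange L ⟶ P.baseChange L) :
    Hom.toSchemeHom (P.galConj L σ r) = P.gal L σ⁻¹ ≫ Hom.toSchemeHom r ≫ P.gal L σ := by
  rw [toSchemeHom_galConj']
  have hr : Hom.toSchemeHom r ≫ pullback.snd P.X.hom (bcSpec K L) =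
      pullback.snd P.X.hom (bcSpec K L) :=
    Over.w r.hom.hom.hom
  change (twistIsoLeft L σ P.X).inv ≫
      pullback.lift (pullback.fst (pullback.snd P.X.hom (bcSpec K L)) (specAut L σ) ≫
        Hom.toSchemeHom r) (pullback.snd (pullback.snd P.X.hom (bcSpec K L)) (specAut L σ)) _ ≫
      (twistIsoLeft L σ P.X).hom = _
  apply pullback.hom_ext
  · simp only [Category.assoc, gal_fst, twistIsoLeft_hom_fst, pullback.lift_fst_assoc,
      twistIsoLeft_inv_fst_assoc]
  · simp only [Category.assoc, twistIsoLeft_hom_snd, gal_snd, pullback.lift_snd,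
      twistIsoLeft_inv_snd]
    rw [reassoc_of% hr, gal_snd_assoc, inv_inv]
    change _ = _ ≫ specAut L σ ≫ specAut L σ⁻¹
    rw [specAut_comp_specAut_symm, Category.comp_id]

/-- Morphisms of abelian varieties are determined by their underlying scheme morphisms. [folklore] -/
theorem hom_ext_toSchemeHom {k : Type u} [Field k] {A B : AbelianVariety k} {f g : A ⟶ B}
    (h : Hom.toSchemeHom f = Hom.toSchemeHom g) : f = g :=
  AbelianVariety.hom_ext f g (Over.OverMorphism.ext h)

/-! ### `σ ↦ galConj σ` is an action by ring automorphisms -/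

/-- `1 • r = r`. [folklore] -/
theorem galConj_one (r : P.baseChange L ⟶ P.baseChange L) : P.galConj L 1 r = r := by
  apply hom_ext_toSchemeHom
  rw [toSchemeHom_galConj, inv_one, gal_one, Category.id_comp]
  exact Category.comp_id _

/-- `(σ τ) • r = σ • (τ • r)`. [folklore] -/
theorem galConj_mul (τ : L ≃ₐ[K] L) (r : P.baseChange L ⟶ P.baseChange L) :
    P.galConj L (σ * τ) r = P.galConj L σ (P.galConj L τ r) := by
  apply hom_ext_toSchemeHom
  simp only [toSchemeHom_galConj, mul_inv_rev, gal_mul, Category.assoc]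

/-- `gal σ ≫ gal σ⁻¹ = 𝟙`. [folklore] -/
@[reassoc]
theorem gal_comp_gal_symm : P.gal L σ ≫ P.gal L σ⁻¹ = 𝟙 _ := by
  rw [← gal_mul, inv_mul_cancel, gal_one]

/-- `gal σ⁻¹ ≫ gal σ = 𝟙`. [folklore] -/
@[reassoc]
theorem gal_symm_comp_gal : P.gal L σ⁻¹ ≫ P.gal L σ = 𝟙 _ := by
  rw [← gal_mul, mul_inv_cancel, gal_one]

/-- `σ • (r ≫ s) = (σ • r) ≫ (σ • s)`. [folklore] -/
theorem galConj_comp (r s : P.baseChange L ⟶ P.baseChange L) :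
    P.galConj L σ (r ≫ s) = P.galConj L σ r ≫ P.galConj L σ s := by
  apply hom_ext_toSchemeHom
  have h : ∀ a b : P.baseChange L ⟶ P.baseChange L,
      Hom.toSchemeHom (a ≫ b) = Hom.toSchemeHom a ≫ Hom.toSchemeHom b :=
    fun _ _ ↦ rfl
  simp only [toSchemeHom_galConj, h, Category.assoc, gal_comp_gal_symm_assoc]

/-- `σ • 𝟙 = 𝟙`. [folklore] -/
theorem galConj_id : P.galConj L σ (𝟙 _) = 𝟙 _ := by
  apply hom_ext_toSchemeHom
  rw [toSchemeHom_galConj]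
  change P.gal L σ⁻¹ ≫ 𝟙 _ ≫ P.gal L σ = 𝟙 _
  rw [Category.id_comp, gal_symm_comp_gal]

/-- **Additivity of Galois conjugation**: `σ • (r + s) = σ • r + σ • s` (the twist functor is
monoidal, so it preserves the pointwise product of homomorphisms, Mathlib `Functor.map_mul`, and
the transport isomorphism is a homomorphism of group objects). [folklore] -/
theorem galConj_add (r s : P.baseChange L ⟶ P.baseChange L) :
    P.galConj L σ (r + s) = P.galConj L σ r + P.galConj L σ s := by
  apply AbelianVariety.hom_ext
  change (twistGrpIso L σ P).inv.hom.hom ≫ (twist L σ).map (r + s).hom.hom.hom ≫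
      (twistGrpIso L σ P).hom.hom.hom = _
  rw [hom_hom_hom_add, hom_hom_hom_add, Functor.map_mul]
  erw [MonObj.mul_comp, MonObj.comp_mul]
  rfl

/-- `σ • 0 = 0`. [folklore] -/
theorem galConj_zero : P.galConj L σ 0 = 0 := by
  have h := P.galConj_add L σ (0 : P.baseChange L ⟶ P.baseChange L) 0
  rw [add_zero] at h
  exact left_eq_add.mp h

/-- **The Galois action on `End(P_L)`**: `Aut(L/K)` acts on the endomorphism ring of `P_L` by
ring automorphisms, `σ • r = galConj σ r` (on schemes `gal σ⁻¹ ≫ r ≫ gal σ`). [folklore] -/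
instance (priority := high) instSMulEnd : SMul (L ≃ₐ[K] L) (End (P.baseChange L)) :=
  ⟨fun σ r ↦ P.galConj L σ r⟩

/-- **The Galois action on `End(P_L)`**: `Aut(L/K)` acts on the endomorphism ring of `P_L` by
ring automorphisms, `σ • r = galConj σ r` (on schemes `gal σ⁻¹ ≫ r ≫ gal σ`; Milne 1986, §16;
Görtz–Wedhorn I, (14.20)). [folklore] -/
instance (priority := high) instMulSemiringActionEnd :
    MulSemiringAction (L ≃ₐ[K] L) (End (P.baseChange L)) where
  one_smul r := P.galConj_one L r
  mul_smul σ τ r := P.galConj_mul L σ τ r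
  smul_zero σ := P.galConj_zero L σ
  smul_add σ r s := P.galConj_add L σ r s
  smul_one σ := P.galConj_id L σ
  smul_mul σ r s := P.galConj_comp L σ s r

/-- `σ • r = galConj σ r` (by `rfl`). [folklore] -/
theorem smul_end_def (r : End (P.baseChange L)) : σ • r = P.galConj L σ r := rfl

/-- On schemes, `σ • r = gal σ⁻¹ ≫ r ≫ gal σ`. [folklore] -/
theorem toSchemeHom_smul_end (r : End (P.baseChange L)) :
    Hom.toSchemeHom (σ • r) = P.gal L σ⁻¹ ≫ Hom.toSchemeHom r ≫ P.gal L σ :=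
  P.toSchemeHom_galConj L σ r

/-! ### Base changes are Galois-fixed; fixed endomorphisms commute with the Galois automorphisms -/

/-- The scheme morphism underlying `f_L` commutes with the Galois automorphisms `gal σ`. [folklore] -/
@[reassoc]
theorem gal_comp_toSchemeHom_baseChange {Q : AbelianVariety K} (f : P ⟶ Q) :
    P.gal L σ ≫ Hom.toSchemeHom (Hom.baseChange L f) =
      Hom.toSchemeHom (Hom.baseChange L f) ≫ Q.gal L σ := by
  have h : Hom.toSchemeHom (Hom.baseChange L f) =
      pullback.lift (pullback.fst _ _ ≫ Hom.toSchemeHom f) (pullback.snd _ _) (by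
        rw [Category.assoc, toSchemeHom_comp_hom (f := f)]; exact pullback.condition) :=
    Over.pullback_map_left _ _
  rw [h]
  apply pullback.hom_ext
  · simp only [Category.assoc, pullback.lift_fst, gal_fst, gal_fst_assoc]
  · simp only [Category.assoc, pullback.lift_snd, gal_snd]
    erw [pullback.lift_snd_assoc]

/-- **Base changes are Galois-fixed**: `σ • f_L = f_L` for `f ∈ End_K(P)`. [folklore] -/
theorem galConj_baseChange (f : End P) : P.galConj L σ (Hom.baseChange L f) = Hom.baseChange L f := by
  apply hom_ext_toSchemeHom
  rw [toSchemeHom_galConj, gal_comp_toSchemeHom_baseChange_assoc, gal_symm_comp_gal]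
  exact Category.comp_id _

/-- `hfix`: **base changes are Galois-fixed**, `σ • f_L = f_L` in `End(P_L)`. [folklore] -/
theorem smul_end_baseChange (f : End P) :
    σ • (End.of (Hom.baseChange L f) : End (P.baseChange L)) = End.of (Hom.baseChange L f) :=
  P.galConj_baseChange L σ f

/-- **A Galois-fixed endomorphism commutes with the Galois automorphisms**: if `σ • r = r` then
`gal σ ≫ r = r ≫ gal σ` on schemes. [folklore] -/
theorem gal_comp_toSchemeHom_of_galConj_eq (r : P.baseChange L ⟶ P.baseChange L)
    (h : P.galConj L σ r = r) :
    P.gal L σ ≫ Hom.toSchemeHom r = Hom.toSchemeHom r ≫ P.gal L σ := by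
  have h' := congrArg Hom.toSchemeHom h
  rw [toSchemeHom_galConj] at h'
  have h'' : P.gal L σ ≫ (P.gal L σ⁻¹ ≫ Hom.toSchemeHom r ≫ P.gal L σ) =
      Hom.toSchemeHom r ≫ P.gal L σ := by
    rw [gal_comp_gal_symm_assoc]
  rwa [h'] at h''

/-! ## Galois descent of endomorphisms along a normal extension of a perfect field -/

section Descent

variable [Normal K L]

omit σ in
/-- **Two `K`-embeddings of a normal extension `L/K` into a field differ by an automorphism of
`L`** (Mathlib `AlgHom.restrictNormal'`): if `λ₁, λ₂ : L → κ` agree on `K` then `λ₂ ∘ γ = λ₁` for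
some `γ ∈ Aut(L/K)`. [folklore] -/
theorem exists_algEquiv_comp_eq {κ : Type*} [Field κ] (l₁ l₂ : L →+* κ)
    (h : l₁.comp (algebraMap K L) = l₂.comp (algebraMap K L)) :
    ∃ γ : L ≃ₐ[K] L, ∀ x, l₂ (γ x) = l₁ x := by
  letI : Algebra L κ := l₂.toAlgebra
  letI : Algebra K κ := (l₂.comp (algebraMap K L)).toAlgebra
  haveI : IsScalarTower K L κ := IsScalarTower.of_algebraMap_eq (fun _ ↦ rfl)
  let φ : L →ₐ[K] κ := { l₁ with commutes' := fun k ↦ (RingHom.congr_fun h k).trans rfl }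
  refine ⟨φ.restrictNormal' L, fun x ↦ ?_⟩
  have e := AlgHom.restrictNormal_commutes φ L x
  exact e

omit σ in
/-- Two points of `Y = P ×_K Spec L` with values in a field and the same image in `P` differ by a
Galois automorphism of `Y`: `y₁ = y₂ ≫ gal γ` for some `γ ∈ Aut(L/K)` (`L/K` normal). [folklore] -/
theorem exists_eq_comp_gal {κ : Type u} [Field κ] (y₁ y₂ : Spec (.of κ) ⟶ P.bcLeft L)
    (h : y₁ ≫ pullback.fst _ _ = y₂ ≫ pullback.fst _ _) :
    ∃ γ : L ≃ₐ[K] L, y₁ = y₂ ≫ P.gal L γ := by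
  -- the two `K`-embeddings `L → κ`
  set l₁ : CommRingCat.of L ⟶ CommRingCat.of κ := Spec.preimage (y₁ ≫ pullback.snd _ _) with hl₁
  set l₂ : CommRingCat.of L ⟶ CommRingCat.of κ := Spec.preimage (y₂ ≫ pullback.snd _ _) with hl₂
  have e₁ : Spec.map l₁ = y₁ ≫ pullback.snd _ _ := Spec.map_preimage _
  have e₂ : Spec.map l₂ = y₂ ≫ pullback.snd _ _ := Spec.map_preimage _
  have hK : l₁.hom.comp (algebraMap K L) = l₂.hom.comp (algebraMap K L) := by
    have h' : Spec.map (CommRingCat.ofHom (algebraMap K L) ≫ l₁) =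
        Spec.map (CommRingCat.ofHom (algebraMap K L) ≫ l₂) := by
      rw [Spec.map_comp, Spec.map_comp, e₁, e₂, Category.assoc, Category.assoc]
      change y₁ ≫ pullback.snd _ _ ≫ bcSpec K L = y₂ ≫ pullback.snd _ _ ≫ bcSpec K L
      rw [← pullback.condition, reassoc_of% h]
    have h'' := Spec.map_injective h'
    exact congrArg (fun f : CommRingCat.of K ⟶ CommRingCat.of κ ↦ f.hom) h''
  obtain ⟨γ, hγ⟩ := exists_algEquiv_comp_eq L l₁.hom l₂.hom hK
  refine ⟨γ⁻¹, ?_⟩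
  apply pullback.hom_ext
  · rw [Category.assoc, gal_fst, h]
  · rw [Category.assoc, gal_snd, inv_inv, ← e₁, ← reassoc_of% e₂, ← Spec.map_comp]
    congr 1
    ext x
    exact (hγ x).symm

variable [PerfectField K]

omit σ in
omit [Normal K L] in
/-- `pr : P ×_K Spec L → P` is geometrically reduced for `K` perfect (EGA IV₂ (4.6.1)). [folklore] -/
instance geometricallyReduced_fst :
    GeometricallyReduced (pullback.fst P.X.hom (bcSpec K L)) :=
  haveI := geometricallyReduced_SpecMap_of_perfectField K L
  MorphismProperty.pullback_fst _ _ ‹_›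

omit σ in
omit [Normal K L] in
/-- The kernel pair `Y ×_P Y` of `pr : Y = P_L → P` is reduced (`K` perfect: `pr` is flat and
geometrically reduced, `Y` is reduced and locally noetherian). [folklore] -/
instance isReduced_pullback_fst_fst :
    IsReduced (pullback (pullback.fst P.X.hom (bcSpec K L)) (pullback.fst P.X.hom (bcSpec K L))) := by
  haveI : IsLocallyNoetherian (P.bcLeft L) :=
    LocallyOfFiniteType.isLocallyNoetherian (P.baseChange L).X.hom
  haveI : IsReduced (P.bcLeft L) := inferInstanceAs (IsReduced (P.baseChange L).X.left)
  haveI : Flat (pullback.fst P.X.hom (bcSpec K L)) := MorphismProperty.pullback_fst _ _ inferInstance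
  exact GeometricallyReduced.isReduced_of_flat_of_isLocallyNoetherian
    (pullback.snd (pullback.fst P.X.hom (bcSpec K L)) (pullback.fst P.X.hom (bcSpec K L)))

omit σ in
/-- **The key equation on the kernel pair.** If a morphism `r : Y → Y` of the scheme
`Y = P ×_K Spec L` commutes with all Galois automorphisms `gal σ`, then `r ≫ pr` coequalises the
two projections `Y ×_P Y ⇉ Y` (checked on field-valued points of the reduced `Y ×_P Y`, where the
two points of `Y` differ by some `gal γ`). [folklore] -/
theorem fst_comp_eq_snd_comp_of_forall_gal_comp (r : P.bcLeft L ⟶ P.bcLeft L)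
    (hrL : r ≫ pullback.snd _ _ = pullback.snd _ _)
    (hr : ∀ σ : L ≃ₐ[K] L, P.gal L σ ≫ r = r ≫ P.gal L σ) :
    pullback.fst (pullback.fst P.X.hom (bcSpec K L)) (pullback.fst P.X.hom (bcSpec K L)) ≫ r ≫
        pullback.fst P.X.hom (bcSpec K L) =
      pullback.snd (pullback.fst P.X.hom (bcSpec K L)) (pullback.fst P.X.hom (bcSpec K L)) ≫ r ≫
        pullback.fst P.X.hom (bcSpec K L) := by
  have hP : r ≫ pullback.fst P.X.hom (bcSpec K L) ≫ P.X.hom =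
      pullback.fst P.X.hom (bcSpec K L) ≫ P.X.hom := by
    rw [pullback.condition, reassoc_of% hrL]
  refine ext_of_fromSpecResidueField_eq _ _ P.X.hom Set.univ dense_univ (fun x _ ↦ ?_) ?_
  · obtain ⟨γ, hγ⟩ := P.exists_eq_comp_gal L
      ((pullback (pullback.fst P.X.hom (bcSpec K L))
        (pullback.fst P.X.hom (bcSpec K L))).fromSpecResidueField x ≫ pullback.fst _ _)
      ((pullback (pullback.fst P.X.hom (bcSpec K L))
        (pullback.fst P.X.hom (bcSpec K L))).fromSpecResidueField x ≫ pullback.snd _ _)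
      (by rw [Category.assoc, Category.assoc, pullback.condition])
    rw [← Category.assoc, hγ, Category.assoc, Category.assoc, reassoc_of% (hr γ), gal_fst]
  · simp only [Category.assoc, hP]
    rw [pullback.condition_assoc]

omit σ in
omit [Normal K L] [PerfectField K] in
/-- `pr : Y = P_L → P` is quasi-compact (it is affine). [folklore] -/
instance quasiCompact_fst : QuasiCompact (pullback.fst P.X.hom (bcSpec K L)) :=
  MorphismProperty.pullback_fst _ _ inferInstance

omit σ in
omit [Normal K L] [PerfectField K] in
/-- `pr : P ×_K Spec L → P` is flat. [folklore] -/
instance flat_fst' : Flat (pullback.fst P.X.hom (bcSpec K L)) :=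
  MorphismProperty.pullback_fst _ _ inferInstance

omit σ in
omit [Normal K L] [PerfectField K] in
/-- `pr : P ×_K Spec L → P` is surjective. [folklore] -/
instance surjective_fst' : Surjective (pullback.fst P.X.hom (bcSpec K L)) :=
  MorphismProperty.pullback_fst _ _ ⟨fun _ ↦ ⟨Classical.arbitrary _, Subsingleton.elim _ _⟩⟩

omit σ in
/-- The descent condition for `r ≫ pr` along `pr` (reduction to the kernel pair and
`fst_comp_eq_snd_comp_of_forall_gal_comp`). [folklore] -/
theorem descent_cond (r : P.bcLeft L ⟶ P.bcLeft L) (hrL : r ≫ pullback.snd _ _ = pullback.snd _ _)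
    (hr : ∀ σ : L ≃ₐ[K] L, P.gal L σ ≫ r = r ≫ P.gal L σ) {Z : Scheme.{u}}
    (g₁ g₂ : Z ⟶ P.bcLeft L)
    (hg : g₁ ≫ pullback.fst P.X.hom (bcSpec K L) = g₂ ≫ pullback.fst P.X.hom (bcSpec K L)) :
    g₁ ≫ r ≫ pullback.fst P.X.hom (bcSpec K L) = g₂ ≫ r ≫ pullback.fst P.X.hom (bcSpec K L) := by
  have h := congrArg (pullback.lift g₁ g₂ hg ≫ ·)
    (P.fst_comp_eq_snd_comp_of_forall_gal_comp L r hrL hr)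
  simpa only [pullback.lift_fst_assoc, pullback.lift_snd_assoc] using h

omit σ in
/-- **Descent of the scheme morphism**: a morphism `r : Y → Y` over `L` commuting with the
Galois automorphisms descends uniquely along the fpqc covering `pr : Y → P` to `r₀ : P → P`
with `pr ≫ r₀ = r ≫ pr` (Mathlib `EffectiveEpi.desc` for flat surjective quasi-compact
morphisms). [folklore] -/
def descentScheme (r : P.bcLeft L ⟶ P.bcLeft L) (hrL : r ≫ pullback.snd _ _ = pullback.snd _ _)
    (hr : ∀ σ : L ≃ₐ[K] L, P.gal L σ ≫ r = r ≫ P.gal L σ) : P.X.left ⟶ P.X.left :=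
  EffectiveEpi.desc (pullback.fst P.X.hom (bcSpec K L)) (r ≫ pullback.fst P.X.hom (bcSpec K L))
    (fun g₁ g₂ hg ↦ P.descent_cond L r hrL hr g₁ g₂ hg)

omit σ in
/-- The defining property of the descended morphism: `pr ≫ r₀ = r ≫ pr`. [folklore] -/
@[reassoc]
theorem fst_descentScheme (r : P.bcLeft L ⟶ P.bcLeft L)
    (hrL : r ≫ pullback.snd _ _ = pullback.snd _ _)
    (hr : ∀ σ : L ≃ₐ[K] L, P.gal L σ ≫ r = r ≫ P.gal L σ) :
    pullback.fst P.X.hom (bcSpec K L) ≫ P.descentScheme L r hrL hr =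
      r ≫ pullback.fst P.X.hom (bcSpec K L) :=
  EffectiveEpi.fac (pullback.fst P.X.hom (bcSpec K L)) (r ≫ pullback.fst P.X.hom (bcSpec K L))
    (fun g₁ g₂ hg ↦ P.descent_cond L r hrL hr g₁ g₂ hg)

omit σ in
omit [Normal K L] [PerfectField K] in
/-- Base change along `Spec L → Spec K` is faithful on `K`-morphisms (`pr : X_L → X` is an
epimorphism, being flat, surjective and quasi-compact). [folklore] -/
theorem bcFunctor_map_injective {X Y : SchemeOver K} {a b : X ⟶ Y}
    (h : (bcFunctor K L).map a = (bcFunctor K L).map b) : a = b := by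
  haveI : Flat (pullback.fst X.hom (bcSpec K L)) := MorphismProperty.pullback_fst _ _ inferInstance
  haveI : Surjective (pullback.fst X.hom (bcSpec K L)) :=
    MorphismProperty.pullback_fst _ _ ⟨fun _ ↦ ⟨Classical.arbitrary _, Subsingleton.elim _ _⟩⟩
  haveI : Epi (pullback.fst X.hom (bcSpec K L)) := Flat.epi_of_flat_of_surjective _
  have h' := congrArg (fun c ↦ CommaMorphism.left c ≫ pullback.fst Y.hom (bcSpec K L)) h
  simp only [Over.pullback_map_left, pullback.lift_fst] at h'
  exact Over.OverMorphism.ext ((cancel_epi _).mp h')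

omit σ in
/-- The descended morphism as a morphism of `K`-schemes `P → P`. [folklore] -/
def descentOver (r : P.baseChange L ⟶ P.baseChange L)
    (hr : ∀ σ : L ≃ₐ[K] L, P.gal L σ ≫ Hom.toSchemeHom r = Hom.toSchemeHom r ≫ P.gal L σ) :
    P.X ⟶ P.X :=
  Over.homMk (P.descentScheme L (Hom.toSchemeHom r) (Over.w r.hom.hom.hom) hr) (by
    haveI : Epi (pullback.fst P.X.hom (bcSpec K L)) := inferInstance
    rw [← cancel_epi (pullback.fst P.X.hom (bcSpec K L)), fst_descentScheme_assoc,
      pullback.condition]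
    change Hom.toSchemeHom r ≫ pullback.snd P.X.hom (bcSpec K L) ≫ bcSpec K L = _
    rw [← Category.assoc]
    congr 1
    exact Over.w r.hom.hom.hom)

omit σ in
/-- **The base change of the descended morphism is `r`.** [folklore] -/
theorem bcFunctor_map_descentOver (r : P.baseChange L ⟶ P.baseChange L)
    (hr : ∀ σ : L ≃ₐ[K] L, P.gal L σ ≫ Hom.toSchemeHom r = Hom.toSchemeHom r ≫ P.gal L σ) :
    (bcFunctor K L).map (P.descentOver L r hr) = r.hom.hom.hom := by
  apply Over.OverMorphism.ext
  apply pullback.hom_ext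
  · erw [pullback.lift_fst]
    exact (P.fst_descentScheme L (Hom.toSchemeHom r) (Over.w r.hom.hom.hom) hr)
  · erw [pullback.lift_snd]
    exact (Over.w r.hom.hom.hom).symm

omit σ in
/-- The descended morphism respects the units (checked after the faithful monoidal base change,
where it is the unit axiom of `r`). [folklore] -/
theorem one_descentOver (r : P.baseChange L ⟶ P.baseChange L)
    (hr : ∀ σ : L ≃ₐ[K] L, P.gal L σ ≫ Hom.toSchemeHom r = Hom.toSchemeHom r ≫ P.gal L σ) :
    η[P.X] ≫ P.descentOver L r hr = η[P.X] := by
  refine bcFunctor_map_injective L ?_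
  rw [Functor.map_comp, bcFunctor_map_descentOver,
    ← cancel_epi (Functor.LaxMonoidal.ε (bcFunctor K L)), ← Functor.obj.η_def_assoc,
    ← Functor.obj.η_def]
  exact IsMonHom.one_hom (f := r.hom.hom.hom)

omit σ in
/-- The descended morphism respects the multiplications (checked after the faithful monoidal
base change, where it is the multiplication axiom of `r`). [folklore] -/
theorem mul_descentOver (r : P.baseChange L ⟶ P.baseChange L)
    (hr : ∀ σ : L ≃ₐ[K] L, P.gal L σ ≫ Hom.toSchemeHom r = Hom.toSchemeHom r ≫ P.gal L σ) :
    μ[P.X] ≫ P.descentOver L r hr = (P.descentOver L r hr ⊗ₘ P.descentOver L r hr) ≫ μ[P.X] := by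
  refine bcFunctor_map_injective L ?_
  rw [Functor.map_comp, Functor.map_comp, bcFunctor_map_descentOver,
    ← cancel_epi (Functor.LaxMonoidal.μ (bcFunctor K L) P.X P.X), ← Functor.obj.μ_def_assoc,
    ← Functor.LaxMonoidal.μ_natural_assoc, bcFunctor_map_descentOver, ← Functor.obj.μ_def]
  exact IsMonHom.mul_hom (f := r.hom.hom.hom)

omit σ in
/-- **Galois descent of an endomorphism**: the endomorphism of `P` over `K` descending an
endomorphism `r` of `P_L` which commutes with the Galois automorphisms. [folklore] -/
def descent (r : P.baseChange L ⟶ P.baseChange L)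
    (hr : ∀ σ : L ≃ₐ[K] L, P.gal L σ ≫ Hom.toSchemeHom r = Hom.toSchemeHom r ≫ P.gal L σ) :
    P ⟶ P :=
  InducedCategory.homMk (Grp.homMk'' (A := P.toGrp) (B := P.toGrp) (P.descentOver L r hr)
    (P.one_descentOver L r hr) (P.mul_descentOver L r hr))

omit σ in
/-- **`(descent r)_L = r`.** [folklore] -/
theorem baseChange_descent (r : P.baseChange L ⟶ P.baseChange L)
    (hr : ∀ σ : L ≃ₐ[K] L, P.gal L σ ≫ Hom.toSchemeHom r = Hom.toSchemeHom r ≫ P.gal L σ) :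
    Hom.baseChange L (P.descent L r hr) = r := by
  apply AbelianVariety.hom_ext
  rw [Hom.baseChange_hom_hom_hom]
  exact P.bcFunctor_map_descentOver L r hr

omit σ in
/-- **Galois descent for endomorphisms of abelian varieties** (Görtz–Wedhorn I, §14.20; Milne 1986,
§16): over a perfect field `K`, for a normal extension `L/K` (e.g. `L = K̄`), an endomorphism of
`P_L` fixed by the Galois action `σ • r = galConj σ r` of `Aut(L/K)` is the base change of a
(unique) endomorphism of `P`. [folklore] -/
theorem exists_baseChange_eq_of_forall_galConj_eq (r : P.baseChange L ⟶ P.baseChange L)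
    (h : ∀ σ : L ≃ₐ[K] L, P.galConj L σ r = r) :
    ∃ f : P ⟶ P, Hom.baseChange L f = r :=
  ⟨P.descent L r (fun σ ↦ P.gal_comp_toSchemeHom_of_galConj_eq L σ r (h σ)),
    P.baseChange_descent L r _⟩

omit σ in
/-- `hdesc` in the form consumed by
`tate_bijective_of_finite_of_theoremOfCube_of_poincare_algebraicClosure_of_galoisDescent`:
every `Aut(L/K)`-fixed element of `End(P_L)` is `f_L` for some `f ∈ End(P)`. [folklore] -/
theorem exists_end_of_baseChange_eq_of_forall_smul_eq (r : End (P.baseChange L))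
    (h : ∀ σ : L ≃ₐ[K] L, σ • r = r) :
    ∃ f : End P, End.of (Hom.baseChange L f) = r :=
  P.exists_baseChange_eq_of_forall_galConj_eq L r h

end Descent

end AbelianVariety

end Literature.AlgebraicGeometry.Motives
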